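/- Fleet lead `ym-wcr-19456-p1` (seat g2), route `WeakCouplingRates`, crux `ColdBoxTwoPointFloorW` (stmt-QuantumFields-19608). -/
-- tree-module: Summits.QuantumFields.YangMills.Theorems.WeakCouplingRatesColdBoxRepresentation
import Summits.QuantumFields.YangMills.Theorems.WeakCouplingRatesColdBoxGaussRef
import Summits.QuantumFields.YangMills.Theorems.WeakCouplingRatesColdBoxLinkSmall
import Summits.QuantumFields.YangMills.Theorems.WeakCouplingRatesColdBoxForestGaugeIntegral
import Summits.QuantumFields.YangMills.Theorems.WeakCouplingRatesColdBoxTilt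

/-!
# Crux `ColdBoxTwoPointFloorW`, stub `stub_boxGaussianDomination`, brick R4: the REPRESENTATION of the small-field conditioned
# cold-wall box state as a bounded tilt of the conditioned Dirichlet Gaussian `boxDirichlet^{⊗3}`

**`integral_cond_boxState_eq_integral_tilted`.**  Let `ρ` be the fundamental representation of `SU(2)`, `Λ = boxEdges 4 (2H+1)`,
`G = coldGoodSet β ε H` (every plaquette touching `Λ` costs `< β^{2ε−1}`), and assume `β > 0`, `H ≥ 1`, the link-smallness window
`((12H²+2H+1)·√(β^{2ε−1}))² < 2`, `boxState(G) ≠ 0` and `gauss3(goodT) ≠ 0`.  Then for every measurable gauge-invariant `X ≥ 0`,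
`∫ X d(boxState ρ β H [|G]) = ∫ X(cfgT β H t) d(((gauss3 H)[|goodT H β ε]).tilted W₀)(t)`, `W₀ = 𝟙_{goodT} · tiltW H β`.
Chain: conditional expectations are ratios of gauge-invariant expectations (`integral_cond_boxState_eq_ratio`), which are ratios of
free-link integrals in the temporal-forest gauge (`integral_boxState_eq_coldFree`, p445325); on `G` every free link is in the upper hemisphere
(`linkCost_le_of_plaqCost_le`, R1), so the product gnomonic chart applies (`lintegral_pi_haar_eq_gnomonic`, p448777); the scaling
`t = √(2β)·w` has constant Jacobian (`exists_lintegral_eq_mul_lintegral_unscaleT`); the chart weight is the Dirichlet Gaussian weight times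
`e^{tiltW}` (`boltzmann_mul_gnomonicDensity_eq`) and Gaussian-weighted integrals are `Z³·` expectations under `gauss3`
(`lintegral_mul_prod_gaussWeight_eq`); finally the normalised tilted conditioned Gaussian has exactly these ratios
(`integral_tilted_cond_eq_ratio`).  All constants cancel.  No sorry; no new definition; standard axioms.  NOT a claim about the mass gap.
-/

set_option autoImplicit false
set_option synthInstance.maxSize 4096

noncomputable section

open MeasureTheory ProbabilityTheory Finset
open scoped ENNReal
open Literature.Probability.LatticeModels (Site)
open Literature.MathematicalPhysics.QuantumLattice
open Literature.MathematicalPhysics.QuantumFieldTheory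
open Literature.MathematicalPhysics.QuantumFieldTheory.LatticeMaxwell
open Literature.MathematicalPhysics.QuantumFieldTheory.AxialGauge
open Literature.MathematicalPhysics.QuantumFieldTheory.GaussianToolkit

namespace Summit.QuantumFields.YangMills.Theorems.WeakCouplingRates

variable {H : ℕ}

/-! ## Step 1: conditional expectations under the box state as ratios of free-link integrals -/

/-- `SU(2)` is second countable (instance form for this file). -/
instance instSecondCountableSU2 : SecondCountableTopology (Matrix.specialUnitaryGroup (Fin 2) ℂ) := secondCountableTopology_SU2

/-- The box state is a probability measure. -/
instance isProbabilityMeasure_boxState (β : ℝ) (H : ℕ) :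
    IsProbabilityMeasure (boxState (fundamentalRep (Fin 2)) β H) :=
  isProbabilityMeasure_ymSpecification _ (continuous_fundamentalRep (Fin 2)) β _ _

/-- The small-field event is gauge invariant. -/
theorem gaugeTransformZd_mem_coldGoodSet_iff (β ε : ℝ) (g : Site 4 → Matrix.specialUnitaryGroup (Fin 2) ℂ)
    (U : LGConfig 4 (Matrix.specialUnitaryGroup (Fin 2) ℂ)) :
    gaugeTransformZd g U ∈ coldGoodSet β ε H ↔ U ∈ coldGoodSet β ε H := by
  simp only [coldGoodSet, Set.mem_compl_iff, Set.mem_setOf_eq, isZdGaugeInvariant_plaquetteObs _ _ _ _ g U]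

/-- The indicator of the small-field event times a gauge-invariant observable is gauge invariant. -/
theorem isZdGaugeInvariant_indicator_coldGoodSet (β ε : ℝ) {X : LGConfig 4 (Matrix.specialUnitaryGroup (Fin 2) ℂ) → ℝ}
    (hX : IsZdGaugeInvariant X) : IsZdGaugeInvariant ((coldGoodSet β ε H).indicator X) := by
  intro g U
  by_cases hU : U ∈ coldGoodSet β ε H
  · rw [Set.indicator_of_mem hU, Set.indicator_of_mem ((gaugeTransformZd_mem_coldGoodSet_iff β ε g U).2 hU), hX]
  · rw [Set.indicator_of_notMem hU, Set.indicator_of_notMem (fun h => hU ((gaugeTransformZd_mem_coldGoodSet_iff β ε g U).1 h))]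

/-- The free-link integral `N(Ψ) = ∫ Ψ(U_v) e^{−βS_Λ(U_v)} dσ^{free}(v)` of the temporal-forest gauge (as an expression). -/
theorem integral_boxState_indicator_eq (β ε : ℝ) (H : ℕ) {X : LGConfig 4 (Matrix.specialUnitaryGroup (Fin 2) ℂ) → ℝ}
    (hXm : Measurable X) (hX : IsZdGaugeInvariant X) :
    ∫ U, (coldGoodSet β ε H).indicator X U ∂(boxState (fundamentalRep (Fin 2)) β H) =
      (∫ v, (coldGoodSet β ε H).indicator X (coldExt (coldExt₁ v)) *
          Real.exp (-β * wilsonBoundaryAction (fundamentalRep (Fin 2)) (boxEdges 4 (2 * H + 1)) (coldExt (coldExt₁ v)))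
        ∂(Measure.pi fun _ : ColdFreeIdx H => haarProbability (Matrix.specialUnitaryGroup (Fin 2) ℂ))) /
      ∫ v, Real.exp (-β * wilsonBoundaryAction (fundamentalRep (Fin 2)) (boxEdges 4 (2 * H + 1)) (coldExt (coldExt₁ v)))
        ∂(Measure.pi fun _ : ColdFreeIdx H => haarProbability (Matrix.specialUnitaryGroup (Fin 2) ℂ)) :=
  integral_boxState_eq_coldFree _ (continuous_fundamentalRep (Fin 2)) β H (hXm.indicator (measurableSet_coldGoodSet β ε H))
    (isZdGaugeInvariant_indicator_coldGoodSet β ε hX)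

/-- **Step 1.**  `E_{boxState[|G]}[X] = N(𝟙_G X) / N(𝟙_G)` for measurable gauge-invariant `X` (`G = coldGoodSet β ε H`, `boxState(G) ≠ 0`). -/
theorem integral_cond_boxState_eq_ratio (β ε : ℝ) (H : ℕ) (hG0 : boxState (fundamentalRep (Fin 2)) β H (coldGoodSet β ε H) ≠ 0)
    {X : LGConfig 4 (Matrix.specialUnitaryGroup (Fin 2) ℂ) → ℝ} (hXm : Measurable X) (hX : IsZdGaugeInvariant X) :
    ∫ U, X U ∂((boxState (fundamentalRep (Fin 2)) β H)[|coldGoodSet β ε H]) =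
      (∫ v, (coldGoodSet β ε H).indicator X (coldExt (coldExt₁ v)) *
          Real.exp (-β * wilsonBoundaryAction (fundamentalRep (Fin 2)) (boxEdges 4 (2 * H + 1)) (coldExt (coldExt₁ v)))
        ∂(Measure.pi fun _ : ColdFreeIdx H => haarProbability (Matrix.specialUnitaryGroup (Fin 2) ℂ))) /
      ∫ v, (coldGoodSet β ε H).indicator (fun _ => (1 : ℝ)) (coldExt (coldExt₁ v)) *
          Real.exp (-β * wilsonBoundaryAction (fundamentalRep (Fin 2)) (boxEdges 4 (2 * H + 1)) (coldExt (coldExt₁ v)))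
        ∂(Measure.pi fun _ : ColdFreeIdx H => haarProbability (Matrix.specialUnitaryGroup (Fin 2) ℂ)) := by
  set μ := boxState (fundamentalRep (Fin 2)) β H with hμ
  set G := coldGoodSet β ε H with hG
  have hGm : MeasurableSet G := measurableSet_coldGoodSet β ε H
  -- numerator and mass as ratios
  have hnum : ∫ U in G, X U ∂μ = ∫ U, G.indicator X U ∂μ := (integral_indicator hGm).symm
  have hmass : μ.real G = ∫ U, G.indicator (fun _ => (1 : ℝ)) U ∂μ := by
    rw [integral_indicator hGm, setIntegral_const, smul_eq_mul, mul_one]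
  rw [integral_cond_eq, hnum, hmass, hG, integral_boxState_indicator_eq β ε H hXm hX,
    integral_boxState_indicator_eq β ε H measurable_const (fun _ _ => rfl)]
  -- abbreviations for the three free-link integrals
  set A := ∫ v, (coldGoodSet β ε H).indicator X (coldExt (coldExt₁ v)) *
      Real.exp (-β * wilsonBoundaryAction (fundamentalRep (Fin 2)) (boxEdges 4 (2 * H + 1)) (coldExt (coldExt₁ v)))
    ∂(Measure.pi fun _ : ColdFreeIdx H => haarProbability (Matrix.specialUnitaryGroup (Fin 2) ℂ)) with hA
  set B := ∫ v, (coldGoodSet β ε H).indicator (fun _ => (1 : ℝ)) (coldExt (coldExt₁ v)) *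
      Real.exp (-β * wilsonBoundaryAction (fundamentalRep (Fin 2)) (boxEdges 4 (2 * H + 1)) (coldExt (coldExt₁ v)))
    ∂(Measure.pi fun _ : ColdFreeIdx H => haarProbability (Matrix.specialUnitaryGroup (Fin 2) ℂ)) with hB
  set Z := ∫ v, Real.exp (-β * wilsonBoundaryAction (fundamentalRep (Fin 2)) (boxEdges 4 (2 * H + 1)) (coldExt (coldExt₁ v)))
    ∂(Measure.pi fun _ : ColdFreeIdx H => haarProbability (Matrix.specialUnitaryGroup (Fin 2) ℂ)) with hZ
  -- `B/Z = μ.real G ≠ 0`, hence `B ≠ 0` and `Z ≠ 0`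
  have hBZ : B / Z = μ.real G := by
    rw [hmass, hG, integral_boxState_indicator_eq β ε H measurable_const (fun _ _ => rfl)]
  have hreal : μ.real G ≠ 0 := by
    rw [measureReal_def]; exact ENNReal.toReal_ne_zero.2 ⟨hG0, measure_ne_top _ _⟩
  have hB0 : B ≠ 0 := fun h => hreal (by rw [← hBZ, h, zero_div])
  have hZ0 : Z ≠ 0 := fun h => hreal (by rw [← hBZ, h, div_zero])
  field_simp

/-! ## Step 2: the free-link integrals in the product gnomonic chart -/

/-- On the small-field event every free link of the gauge-fixed configuration is in the upper hemisphere (R1, `linkCost_le_of_plaqCost_le`),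
given the window `((12H²+2H+1)·√(β^{2ε−1}))² < 2`. -/
theorem re_trace_pos_of_mem_coldGoodSet {β ε : ℝ} (hβ : 0 < β) (hH : 1 ≤ H)
    (hη : ((12 * (H : ℝ) ^ 2 + 2 * H + 1) * Real.sqrt (β ^ (2 * ε - 1))) ^ 2 < 2)
    (v : ColdFreeCfg (G := Matrix.specialUnitaryGroup (Fin 2) ℂ) H) (hv : coldExt (coldExt₁ v) ∈ coldGoodSet β ε H)
    (e : ColdFreeIdx H) : 0 < (((v e : Matrix.specialUnitaryGroup (Fin 2) ℂ) : Matrix (Fin 2) (Fin 2) ℂ).trace).re := by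
  set V := coldExt (coldExt₁ v) with hV
  have hδ2 : Real.sqrt (β ^ (2 * ε - 1)) ^ 2 = β ^ (2 * ε - 1) := Real.sq_sqrt (Real.rpow_nonneg hβ.le _)
  have hcost : ∀ p ∈ plaquettesTouching (boxEdges 4 (2 * H + 1)),
      plaqCostAt (fundamentalRep (Fin 2)) p.1 p.2.1.1 p.2.1.2 V ≤ Real.sqrt (β ^ (2 * ε - 1)) ^ 2 := by
    intro p hp
    rw [hδ2]
    simp only [coldGoodSet, Set.mem_compl_iff, Set.mem_setOf_eq, not_exists, not_and, not_le] at hv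
    have := hv p hp
    simp only [plaqCostAt, Nat.cast_ofNat]
    exact this.le
  have hout : ∀ e, e ∉ boxEdges 4 (2 * H + 1) → V e = 1 := fun e he => coldExt_apply_not_mem _ he
  have hforest : ∀ x : Site 4, (∀ k : Fin 4, 1 ≤ x k ∧ x k + 1 ≤ 2 * (H : ℤ)) → V (x, 0) = 1 := by
    intro x hx
    have hmem : (x, (0 : Fin 4)) ∈ boxEdges 4 (2 * H + 1) := by
      rw [mem_boxEdges_iff]
      refine ⟨fun k => ⟨by linarith [(hx k).1], ?_⟩, ?_⟩
      · have := (hx k).2; push_cast; omega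
      · have := (hx 0).2; push_cast; omega
    rw [hV, coldExt_apply_mem _ ⟨_, hmem⟩, coldExt₁, dif_pos ⟨rfl, hx⟩]
  have hlink := linkCost_le_of_plaqCost_le hH V hout hforest (Real.sqrt_nonneg _) hcost e.1.1
  have hVe : V e.1.1 = v e := by
    rw [hV, coldExt_apply_mem _ e.1, coldExt₁, dif_neg e.2]
  rw [hVe] at hlink
  linarith

/-- **Step 2.**  For measurable `Ψ ≥ 0`: `N(𝟙_G Ψ) = (∫⁻ 𝟙_G(chartCfg w) Ψ(chartCfg w) e^{−βS(chartCfg w)} Π_e gnomonicDensity(w_e) dw).toReal`. -/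
theorem freeIntegral_indicator_eq_lintegral_chart {β ε : ℝ} (hβ : 0 < β) (hH : 1 ≤ H)
    (hη : ((12 * (H : ℝ) ^ 2 + 2 * H + 1) * Real.sqrt (β ^ (2 * ε - 1))) ^ 2 < 2)
    {Ψ : LGConfig 4 (Matrix.specialUnitaryGroup (Fin 2) ℂ) → ℝ} (hΨm : Measurable Ψ) (hΨ0 : ∀ U, 0 ≤ Ψ U) :
    ∫ v, (coldGoodSet β ε H).indicator Ψ (coldExt (coldExt₁ v)) *
          Real.exp (-β * wilsonBoundaryAction (fundamentalRep (Fin 2)) (boxEdges 4 (2 * H + 1)) (coldExt (coldExt₁ v)))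
        ∂(Measure.pi fun _ : ColdFreeIdx H => haarProbability (Matrix.specialUnitaryGroup (Fin 2) ℂ)) =
      (∫⁻ w, ENNReal.ofReal ((coldGoodSet β ε H).indicator Ψ (chartCfg w) *
          Real.exp (-β * wilsonBoundaryAction (fundamentalRep (Fin 2)) (boxEdges 4 (2 * H + 1)) (chartCfg w))) *
          ∏ e, gnomonicDensity (w e) ∂(Measure.pi fun _ : ColdFreeIdx H => (volume : Measure (Fin 3 → ℝ)))).toReal := by
  have hSm : Measurable fun U : LGConfig 4 (Matrix.specialUnitaryGroup (Fin 2) ℂ) =>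
      Real.exp (-β * wilsonBoundaryAction (fundamentalRep (Fin 2)) (boxEdges 4 (2 * H + 1)) U) :=
    (Real.continuous_exp.comp (continuous_const.mul (continuous_wilsonBoundaryAction _ (continuous_fundamentalRep (Fin 2)) _))).measurable
  have hUm : Measurable fun v : ColdFreeCfg (G := Matrix.specialUnitaryGroup (Fin 2) ℂ) H => coldExt (coldExt₁ v) :=
    measurable_coldExt.comp measurable_coldExt₁
  set f : LGConfig 4 (Matrix.specialUnitaryGroup (Fin 2) ℂ) → ℝ := fun U => (coldGoodSet β ε H).indicator Ψ U *
    Real.exp (-β * wilsonBoundaryAction (fundamentalRep (Fin 2)) (boxEdges 4 (2 * H + 1)) U) with hf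
  have hfm : Measurable f := (hΨm.indicator (measurableSet_coldGoodSet β ε H)).mul hSm
  have hf0 : ∀ U, 0 ≤ f U := fun U => mul_nonneg (Set.indicator_nonneg (fun _ _ => hΨ0 _) _) (Real.exp_pos _).le
  -- Bochner → Lebesgue
  rw [show (∫ v, (coldGoodSet β ε H).indicator Ψ (coldExt (coldExt₁ v)) *
      Real.exp (-β * wilsonBoundaryAction (fundamentalRep (Fin 2)) (boxEdges 4 (2 * H + 1)) (coldExt (coldExt₁ v)))
      ∂(Measure.pi fun _ : ColdFreeIdx H => haarProbability (Matrix.specialUnitaryGroup (Fin 2) ℂ))) =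
      ∫ v, f (coldExt (coldExt₁ v)) ∂(Measure.pi fun _ : ColdFreeIdx H => haarProbability (Matrix.specialUnitaryGroup (Fin 2) ℂ))
      from rfl,
    integral_eq_lintegral_of_nonneg_ae (ae_of_all _ fun v => hf0 _) ((hfm.comp hUm).aestronglyMeasurable)]
  congr 1
  -- the product chart
  have key := lintegral_pi_haar_eq_gnomonic (ι := ColdFreeIdx H) (fun v => ENNReal.ofReal (f (coldExt (coldExt₁ v))))
    (ENNReal.measurable_ofReal.comp (hfm.comp hUm)) (by
      intro v hv
      obtain ⟨e, he⟩ := hv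
      have hnot : coldExt (coldExt₁ v) ∉ coldGoodSet β ε H := fun hmem =>
        absurd (re_trace_pos_of_mem_coldGoodSet hβ hH hη v hmem e) (not_lt.2 he)
      simp [hf, Set.indicator_of_notMem hnot])
  rw [key]
  refine lintegral_congr fun w => ?_
  simp only [hf, coldExt_coldExt₁_gnomonicChart]

/-! ## Step 3: scaling, density identity, and the Gaussian reference -/

/-- **Step 3.**  For measurable `Ψ ≥ 0`: the chart integral of Step 2 equals
`a · (2π²)^{−n} · Z³ · ∫⁻ 𝟙_{goodT}(t) Ψ(cfgT t) e^{tiltW t} d(gauss3 H)`, with the constant `a` of the change of variables. -/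
theorem lintegral_chart_eq_const_mul_lintegral_gauss3 {β ε : ℝ}
    {Ψ : LGConfig 4 (Matrix.specialUnitaryGroup (Fin 2) ℂ) → ℝ} (hΨm : Measurable Ψ) (hΨ0 : ∀ U, 0 ≤ Ψ U)
    {a : ℝ≥0∞} (ha : ∀ F : (ColdFreeIdx H → (Fin 3 → ℝ)) → ℝ≥0∞, Measurable F →
      ∫⁻ w, F w ∂(volume : Measure (ColdFreeIdx H → (Fin 3 → ℝ))) = a * ∫⁻ t, F (unscaleT H β t) ∂(volume : Measure (TSpace H))) :
    ∫⁻ w, ENNReal.ofReal ((coldGoodSet β ε H).indicator Ψ (chartCfg w) *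
          Real.exp (-β * wilsonBoundaryAction (fundamentalRep (Fin 2)) (boxEdges 4 (2 * H + 1)) (chartCfg w))) *
          ∏ e, gnomonicDensity (w e) ∂(Measure.pi fun _ : ColdFreeIdx H => (volume : Measure (Fin 3 → ℝ))) =
      a * ENNReal.ofReal ((1 / (2 * Real.pi ^ 2)) ^ Fintype.card (ColdFreeIdx H)) *
        gaussZ (Qmat (fun e => e ∉ dirFreeEdges H) dirCorner (2 * H + 3)) ^ 3 *
        ∫⁻ t, ENNReal.ofReal ((goodT H β ε).indicator (fun t => Ψ (cfgT H β t) * Real.exp (tiltW H β t)) t) ∂(gauss3 H) := by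
  have hSm : Measurable fun U : LGConfig 4 (Matrix.specialUnitaryGroup (Fin 2) ℂ) =>
      Real.exp (-β * wilsonBoundaryAction (fundamentalRep (Fin 2)) (boxEdges 4 (2 * H + 1)) U) :=
    (Real.continuous_exp.comp (continuous_const.mul (continuous_wilsonBoundaryAction _ (continuous_fundamentalRep (Fin 2)) _))).measurable
  have hind : Measurable fun U : LGConfig 4 (Matrix.specialUnitaryGroup (Fin 2) ℂ) => (coldGoodSet β ε H).indicator Ψ U :=
    hΨm.indicator (measurableSet_coldGoodSet β ε H)
  have hdens : Measurable fun w : ColdFreeIdx H → (Fin 3 → ℝ) => ∏ e, gnomonicDensity (w e) :=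
    Finset.measurable_prod _ fun e _ => measurable_gnomonicDensity.comp (measurable_pi_apply e)
  have hF : Measurable fun w : ColdFreeIdx H → (Fin 3 → ℝ) => ENNReal.ofReal ((coldGoodSet β ε H).indicator Ψ (chartCfg w) *
      Real.exp (-β * wilsonBoundaryAction (fundamentalRep (Fin 2)) (boxEdges 4 (2 * H + 1)) (chartCfg w))) *
      ∏ e, gnomonicDensity (w e) :=
    (ENNReal.measurable_ofReal.comp ((hind.comp measurable_chartCfg).mul (hSm.comp measurable_chartCfg))).mul hdens
  rw [← volume_pi, ha _ hF]
  -- pointwise: the density identity and the indicator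
  have hpt : ∀ t : TSpace H, ENNReal.ofReal ((coldGoodSet β ε H).indicator Ψ (chartCfg (unscaleT H β t)) *
      Real.exp (-β * wilsonBoundaryAction (fundamentalRep (Fin 2)) (boxEdges 4 (2 * H + 1)) (chartCfg (unscaleT H β t)))) *
      ∏ e, gnomonicDensity (unscaleT H β t e) =
      ENNReal.ofReal ((1 / (2 * Real.pi ^ 2)) ^ Fintype.card (ColdFreeIdx H)) *
        (ENNReal.ofReal ((goodT H β ε).indicator (fun t => Ψ (cfgT H β t) * Real.exp (tiltW H β t)) t) *
          ∏ i, gaussWeight (Qmat (fun e => e ∉ dirFreeEdges H) dirCorner (2 * H + 3)) (t i)) := by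
    intro t
    have hcfg : chartCfg (unscaleT H β t) = cfgT H β t := rfl
    rw [hcfg, ENNReal.ofReal_mul (Set.indicator_nonneg (fun _ _ => hΨ0 _) _), mul_assoc, boltzmann_mul_gnomonicDensity_eq β t]
    by_cases ht : t ∈ goodT H β ε
    · have hU : cfgT H β t ∈ coldGoodSet β ε H := ht
      rw [Set.indicator_of_mem hU, Set.indicator_of_mem ht, ENNReal.ofReal_mul (hΨ0 _)]
      ring
    · have hU : cfgT H β t ∉ coldGoodSet β ε H := ht
      rw [Set.indicator_of_notMem hU, Set.indicator_of_notMem ht]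
      simp
  simp_rw [hpt]
  have hg : Measurable fun t : TSpace H =>
      ENNReal.ofReal ((goodT H β ε).indicator (fun t => Ψ (cfgT H β t) * Real.exp (tiltW H β t)) t) :=
    ENNReal.measurable_ofReal.comp ((((hΨm.comp (measurable_cfgT β)).mul
      (Real.measurable_exp.comp (measurable_tiltW β))).indicator (measurableSet_goodT β ε)))
  have hm2 : Measurable fun t : TSpace H =>
      ENNReal.ofReal ((goodT H β ε).indicator (fun t => Ψ (cfgT H β t) * Real.exp (tiltW H β t)) t) *
        ∏ i, gaussWeight (Qmat (fun e => e ∉ dirFreeEdges H) dirCorner (2 * H + 3)) (t i) :=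
    hg.mul (Finset.measurable_prod _ fun i _ => (measurable_gaussWeight _).comp (measurable_pi_apply i))
  rw [lintegral_const_mul _ hm2, lintegral_mul_prod_gaussWeight_eq _ hg]
  ring

/-! ## Step 4: the tilted conditioned Gaussian has the same ratios -/

/-- **Step 4.**  For measurable `φ ≥ 0` on `TSpace H` and a measurable set `S` with `γ(S) ≠ 0` (`γ = gauss3 H`):
`∫ φ d((γ[|S]).tilted (𝟙_S W)) = (∫⁻ 𝟙_S φ e^{W} dγ).toReal / (∫⁻ 𝟙_S e^{W} dγ).toReal`. -/
theorem integral_tilted_cond_eq_ratio {Ω : Type*} [MeasurableSpace Ω] (γ : Measure Ω) [IsFiniteMeasure γ] {S : Set Ω}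
    (hS : MeasurableSet S) (hS0 : γ S ≠ 0) {W : Ω → ℝ} (hW : Measurable W) {φ : Ω → ℝ} (hφm : Measurable φ) (hφ0 : ∀ ω, 0 ≤ φ ω) :
    ∫ ω, φ ω ∂((γ[|S]).tilted (S.indicator W)) =
      (∫⁻ ω, ENNReal.ofReal (S.indicator (fun ω => φ ω * Real.exp (W ω)) ω) ∂γ).toReal /
        (∫⁻ ω, ENNReal.ofReal (S.indicator (fun ω => Real.exp (W ω)) ω) ∂γ).toReal := by
  rw [integral_tilted]
  set K := ∫ ω, Real.exp (S.indicator W ω) ∂(γ[|S]) with hK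
  have hsmul : ∀ ω, (Real.exp (S.indicator W ω) / K) • φ ω = K⁻¹ * (Real.exp (S.indicator W ω) * φ ω) := fun ω => by
    rw [smul_eq_mul]; ring
  simp_rw [hsmul]
  rw [integral_const_mul, integral_cond_eq, hK, integral_cond_eq]
  -- both set integrals as integrals of indicators, then as Lebesgue integrals
  have h1 : ∫ ω in S, Real.exp (S.indicator W ω) * φ ω ∂γ = ∫ ω, S.indicator (fun ω => φ ω * Real.exp (W ω)) ω ∂γ := by
    rw [← integral_indicator hS]
    refine integral_congr_ae (ae_of_all _ fun ω => ?_)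
    by_cases hω : ω ∈ S
    · simp only [Set.indicator_of_mem hω]; ring
    · simp only [Set.indicator_of_notMem hω]
  have h2 : ∫ ω in S, Real.exp (S.indicator W ω) ∂γ = ∫ ω, S.indicator (fun ω => Real.exp (W ω)) ω ∂γ := by
    rw [← integral_indicator hS]
    refine integral_congr_ae (ae_of_all _ fun ω => ?_)
    by_cases hω : ω ∈ S
    · simp only [Set.indicator_of_mem hω]
    · simp only [Set.indicator_of_notMem hω]
  have hm1 : Measurable fun ω => S.indicator (fun ω => φ ω * Real.exp (W ω)) ω :=
    (hφm.mul (Real.measurable_exp.comp hW)).indicator hS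
  have hm2 : Measurable fun ω => S.indicator (fun ω => Real.exp (W ω)) ω := (Real.measurable_exp.comp hW).indicator hS
  have e1 : ∫ ω, S.indicator (fun ω => φ ω * Real.exp (W ω)) ω ∂γ =
      (∫⁻ ω, ENNReal.ofReal (S.indicator (fun ω => φ ω * Real.exp (W ω)) ω) ∂γ).toReal :=
    integral_eq_lintegral_of_nonneg_ae (ae_of_all _ fun ω => Set.indicator_nonneg
      (fun ω _ => mul_nonneg (hφ0 ω) (Real.exp_pos _).le) _) hm1.aestronglyMeasurable
  have e2 : ∫ ω, S.indicator (fun ω => Real.exp (W ω)) ω ∂γ =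
      (∫⁻ ω, ENNReal.ofReal (S.indicator (fun ω => Real.exp (W ω)) ω) ∂γ).toReal :=
    integral_eq_lintegral_of_nonneg_ae (ae_of_all _ fun ω => Set.indicator_nonneg (fun _ _ => by positivity) _)
      hm2.aestronglyMeasurable
  rw [h1, h2, e1, e2]
  have hr : γ.real S ≠ 0 := by
    rw [measureReal_def]; exact ENNReal.toReal_ne_zero.2 ⟨hS0, measure_ne_top _ _⟩
  field_simp

/-! ## The representation theorem -/

/-- `gauss3 H` is a probability measure. -/
instance isProbabilityMeasure_gauss3 (H : ℕ) : IsProbabilityMeasure (gauss3 H) := by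
  unfold gauss3; infer_instance

/-- **THE REPRESENTATION.**  Under the link-smallness window, for every measurable gauge-invariant `X ≥ 0`: the expectation of `X` under the
cold-wall box state conditioned on the small-field event equals the expectation of `X ∘ cfgT` under the tilt by `𝟙_{goodT}·tiltW` of the
Dirichlet Gaussian `boxDirichlet^{⊗3}` conditioned on `goodT`. -/
theorem integral_cond_boxState_eq_integral_tilted {β ε : ℝ} (hβ : 0 < β) (hH : 1 ≤ H)
    (hη : ((12 * (H : ℝ) ^ 2 + 2 * H + 1) * Real.sqrt (β ^ (2 * ε - 1))) ^ 2 < 2)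
    (hG0 : boxState (fundamentalRep (Fin 2)) β H (coldGoodSet β ε H) ≠ 0) (hγ : gauss3 H (goodT H β ε) ≠ 0)
    {X : LGConfig 4 (Matrix.specialUnitaryGroup (Fin 2) ℂ) → ℝ} (hXm : Measurable X) (hXinv : IsZdGaugeInvariant X)
    (hX0 : ∀ U, 0 ≤ X U) :
    ∫ U, X U ∂((boxState (fundamentalRep (Fin 2)) β H)[|coldGoodSet β ε H]) =
      ∫ t, X (cfgT H β t) ∂(((gauss3 H)[|goodT H β ε]).tilted ((goodT H β ε).indicator (tiltW H β))) := by
  obtain ⟨a, ha0, hatop, ha⟩ := exists_lintegral_eq_mul_lintegral_unscaleT (H := H) hβ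
  rw [integral_tilted_cond_eq_ratio (gauss3 H) (measurableSet_goodT β ε) hγ (measurable_tiltW β)
      (φ := fun t => X (cfgT H β t)) (hXm.comp (measurable_cfgT β)) (fun t => hX0 _),
    integral_cond_boxState_eq_ratio β ε H hG0 hXm hXinv,
    freeIntegral_indicator_eq_lintegral_chart hβ hH hη hXm hX0,
    freeIntegral_indicator_eq_lintegral_chart hβ hH hη measurable_const (fun _ => zero_le_one),
    lintegral_chart_eq_const_mul_lintegral_gauss3 hXm hX0 ha,
    lintegral_chart_eq_const_mul_lintegral_gauss3 measurable_const (fun _ => zero_le_one) ha]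
  simp only [one_mul, ENNReal.toReal_mul]
  obtain ⟨-, hZ0, hZtop⟩ := boxDirichlet_eq_withDensity H
  have hC : (a.toReal * (ENNReal.ofReal ((1 / (2 * Real.pi ^ 2)) ^ Fintype.card (ColdFreeIdx H))).toReal *
      ((gaussZ (Qmat (fun e => e ∉ dirFreeEdges H) dirCorner (2 * H + 3))) ^ 3).toReal) ≠ 0 := by
    refine mul_ne_zero (mul_ne_zero (ENNReal.toReal_ne_zero.2 ⟨ha0, hatop⟩) ?_) ?_
    · rw [ENNReal.toReal_ofReal (by positivity)]; positivity
    · exact ENNReal.toReal_ne_zero.2 ⟨pow_ne_zero _ hZ0, ENNReal.pow_ne_top hZtop⟩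
  rw [mul_div_mul_left _ _ hC]

end Summit.QuantumFields.YangMills.Theorems.WeakCouplingRates

end
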